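import Literature.AlgebraicGeometry.Motives.ProperIntegralPointsTwist
import Literature.NumberTheory.DiophantineGeometry.AbelianSchemeModelReduction
import Literature.NumberTheory.GaloisRepresentations.AbsIntegersValuationSubringsMaximalIdeals
import Literature.NumberTheory.GaloisRepresentations.AbsGaloisConjByPrime
import Literature.AlgebraicGeometry.Motives.AbelianVarietyGoodReductionConjugate
import HarnessLib

/-!
# The Frobenius translate of the reduction of a point along a conjugate embedding `ι ∘ σ̃`
# — [Shimura 1998, §18.6 proof of Thm. 18.6, p. 127 «`(Y^σ)~ = Ỹ^f`», p. 128 «`(t^σ)~ = π(t̃)`»]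

Topic `Literature/AlgebraicGeometry/Motives`; THEOREMS ONLY (no definition, no named fact, no instance, no notation; net
Literature debt 0).  Cell `hodgecm-mathlib` (D-0151), row II-1, edition E4 / Q5, pieces (T1)+(T2)+(T3) of the Q5 map
(slot «Frobenius translate at the base point» of the (TW)-harness).  Notation: `K` a number field, `v` a finite place,
`𝓞ᵥ = 𝓞_{K,(v)}`, `Ω = \bar{K_v}` with valuation ring `R` (`closureValuationSubring`) and structure map `f : 𝓞ᵥ → R`,
`ι : K̄ → Ω` the chosen embedding (`absClosureEmbedding`), `𝔓₀ = adicCompletionPrime K v`, `ℤ̄_{𝔓₀} ⊆ K̄` its valuation ring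
(`absIntegersValuationSubring`), `σ̃` an automorphism of `K̄` with `σ̃ x ≡ x^q (mod 𝔓₀)` on `ℤ̄_K`, over `γ ∈ Aut(K)`, `γ • v = v`.

* §1 (T3, generic) `reducePointMonoidHom_left_eq_frobenius_comp_of_conj`: for valuation rings `V ⊆ L`, `R ⊆ Ω` over `O`,
  `e : L → Ω` with `e(V) ⊆ R`, `s : L → L` with `s(V) ⊆ V` over `φ : O → O`, and the residue law `e(s z) ≡ e(z)^{pⁿ}` in `κ(R)`:
  the reductions of the `Ω`-points `Spec (e ∘ s) ≫ ξ` (over the twisted base point `(R, f ∘ φ)`) and `Spec e ≫ ξ` (over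
  `(R, f)`) of a proper `O`-group scheme differ by `Spec Frobⁿ_{κ(R)}` — B-p19's `reducePointMonoidHom_naturality₂` thrice.
* §2 (T1, private plumbing — the public (T1)/(T2) API is B-p09's `GaloisRepresentations/AbsIntegersValuationSubringFrobenius`)
  `ℤ̄_{𝔓₀}` versus `R` along `ι`: `𝔓₀ = ι⁻¹(𝔪_R) ∩ ℤ̄_K`, `ι(ℤ̄_{𝔓₀}) ⊆ R`, `ι(n/d) ∈ 𝔪_R` for `n ∈ 𝔓₀ ∌ d`; public:
  `algebraMap_valuationSubringAtPrime_mem_absIntegersValuationSubring` (`𝓞ᵥ ⊆ ℤ̄_{𝔓₀}`, the hypothesis `hf'` of §4).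
* §3 (T2, private) `σ̃ ℤ̄_{𝔓₀} ⊆ ℤ̄_{𝔓₀}` and the residue law `ι(σ̃ z) ≡ ι(z)^q (mod 𝔪_R)`.
* §4 (T3, number field) `reducePointMonoidHom_left_eq_frobenius_comp_of_frobeniusAt` — the slot statement.

HC_CM is proved only modulo the 7 printed citations until rung 0 closes.
-/

set_option autoImplicit false

-- Compositions through `(specRingHomOver R f g).left = Spec k` etc. are definitional only above `instances` transparency
-- (as in `ProperIntegralPointsTwist`).
set_option backward.isDefEq.respectTransparency false

noncomputable section

open CategoryTheory CategoryTheory.Limits AlgebraicGeometry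

universe u

namespace Literature.AlgebraicGeometry.Motives

/-! ### §1. (T3, generic) `red(Spec (e ∘ s) ≫ ξ) = Spec Frobⁿ ≫ red(Spec e ≫ ξ)` -/

section Generic

variable {O L Ω : Type u} [CommRing O] [Field L] [Field Ω] (V : ValuationSubring L) (R : ValuationSubring Ω)
  (f' : O →+* V) (f : O →+* R) (φ : O →+* O) (e : L →+* Ω) (eV : V →+* R) (s : L →+* L) (sV : V →+* V)
  (p n : ℕ)

/-- `Spec b ≫ Spec a = Spec c` from `b ∘ a = c`. [folklore] -/
private theorem specMap_comp_specMap_of_comp_eq {A B C : Type u} [CommRing A] [CommRing B] [CommRing C]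
    (a : A →+* B) (b : B →+* C) (c : A →+* C) (h : b.comp a = c) :
    Spec.map (CommRingCat.ofHom b) ≫ Spec.map (CommRingCat.ofHom a) = Spec.map (CommRingCat.ofHom c) := by
  rw [← Spec.map_comp, ← CommRingCat.ofHom_comp, h]

/-- `Spec a ≫ Spec b ≫ Spec c = Spec d ≫ Spec e` from the pointwise identity `a (b (c x)) = d (e x)`. [folklore] -/
private theorem specMap₃_eq_specMap₂ {X Y Z W U : Type u} [CommRing X] [CommRing Y] [CommRing Z] [CommRing W]
    [CommRing U] (c : X →+* Y) (b : Y →+* Z) (a : Z →+* W) (e' : X →+* U) (d : U →+* W)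
    (h : ∀ x, a (b (c x)) = d (e' x)) :
    Spec.map (CommRingCat.ofHom a) ≫ Spec.map (CommRingCat.ofHom b) ≫ Spec.map (CommRingCat.ofHom c) =
      Spec.map (CommRingCat.ofHom d) ≫ Spec.map (CommRingCat.ofHom e') := by
  rw [specMap_comp_specMap_of_comp_eq c b _ rfl, specMap_comp_specMap_of_comp_eq _ a _ rfl,
    specMap_comp_specMap_of_comp_eq e' d _ rfl]
  congr 2; exact RingHom.ext fun x => h x

/-- `Spec a ≫ Spec b = Spec d ≫ Spec e` from the pointwise identity `a (b x) = d (e x)`. [folklore] -/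
private theorem specMap₂_eq_specMap₂ {X Y W U : Type u} [CommRing X] [CommRing Y] [CommRing W] [CommRing U]
    (b : X →+* Y) (a : Y →+* W) (e' : X →+* U) (d : U →+* W) (h : ∀ x, a (b x) = d (e' x)) :
    Spec.map (CommRingCat.ofHom a) ≫ Spec.map (CommRingCat.ofHom b) =
      Spec.map (CommRingCat.ofHom d) ≫ Spec.map (CommRingCat.ofHom e') := by
  rw [specMap_comp_specMap_of_comp_eq b a _ rfl, specMap_comp_specMap_of_comp_eq e' d _ rfl]
  congr 2; exact RingHom.ext fun x => h x

/-- **(T3) «Frobenius translate at the base point», generic form.**  Valuation rings `V ⊆ L`, `R ⊆ Ω` over `O`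
(structure maps `f'`, `f`); `e : L → Ω` restricting to `eV : V → R` with `eV ∘ f' = f`; `s : L → L` restricting to `sV : V → V`
over `φ : O → O` (`sV ∘ f' = f' ∘ φ`); residue law `e(s z) ≡ e(z)^{pⁿ}` in `κ(R)`.  Then for a proper `O`-group scheme `𝒳`, an
`L`-point `ξ` of `𝒳` over `V`, and `Ω`-points `Q` over `(R, f)`, `P′` over `(R, f ∘ φ)` lying over `Spec e ≫ ξ` and
`Spec (e ∘ s) ≫ ξ`: `red(P′) = Spec Frobⁿ_{κ(R)} ≫ red(Q)` on underlying `κ(R)`-points (uniqueness of extensions over valuation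
rings, along `Spec eV` twisted and untwisted and along `Spec sV`; the `V`-side reductions are read in `κ(R)` along `res_R ∘ eV`).
[cite: Hartshorne1977, II.4.7] [cite: Shimura1998, §18.6 proof of Thm. 18.6, pp. 127–128] -/
theorem reducePointMonoidHom_left_eq_frobenius_comp_of_conj [ExpChar (IsLocalRing.ResidueField R) p]
    (heV : ∀ z : V, ((eV z : R) : Ω) = e (z : L)) (hef : eV.comp f' = f)
    (hsV : ∀ z : V, ((sV z : V) : L) = s (z : L)) (hsf : sV.comp f' = f'.comp φ)
    (hres : ∀ z : V, IsLocalRing.residue R (eV (sV z)) = (IsLocalRing.residue R (eV z)) ^ p ^ n)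
    (𝒳 : SchemeOver O) [GrpObj 𝒳] [IsProper 𝒳.hom] (ξ : specFractionField V f' ⟶ 𝒳)
    (Q : specFractionField R f ⟶ 𝒳) (P' : specFractionField R (f.comp φ) ⟶ 𝒳)
    (hQ : Q.left = Spec.map (CommRingCat.ofHom e) ≫ ξ.left)
    (hP' : P'.left = Spec.map (CommRingCat.ofHom (e.comp s)) ≫ ξ.left) :
    (reducePointMonoidHom R (f.comp φ) 𝒳 (IsLocalRing.residue R) P').left =
      Spec.map (CommRingCat.ofHom (iterateFrobenius (IsLocalRing.ResidueField R) p n)) ≫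
        (reducePointMonoidHom R f 𝒳 (IsLocalRing.residue R) Q).left := by
  -- the `κ(R)`-valued residue map of `V` along `e`
  let gV : V →+* IsLocalRing.ResidueField R := (IsLocalRing.residue R).comp eV
  -- pointwise identities (`algebraMap ↥V L z` is `↑z` definitionally)
  have heV' : ∀ z : V, algebraMap R Ω (eV z) = e (algebraMap V L z) := heV
  have hsV' : ∀ z : V, algebraMap V L (sV z) = s (algebraMap V L z) := hsV
  have pf : ∀ x, eV (f' x) = f x := fun x => RingHom.congr_fun hef x; have ps : ∀ x, sV (f' x) = f' (φ x) := fun x => RingHom.congr_fun hsf x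
  have pF : ∀ z : V, gV (sV z) = iterateFrobenius _ p n (gV z) := fun z => by
    change IsLocalRing.residue R (eV (sV z)) = iterateFrobenius _ p n (IsLocalRing.residue R (eV z)); rw [iterateFrobenius_def, hres z]
  -- (1) along `Spec eV : Spec (R, f) → Spec (V, f')`
  let τ₁ : specValuationSubring R f ⟶ specValuationSubring V f' := Over.homMk (Spec.map (CommRingCat.ofHom eV)) (specMap_comp_specMap_of_comp_eq f' eV f hef)
  let τ₁' : specFractionField R f ⟶ specFractionField V f' :=
    Over.homMk (Spec.map (CommRingCat.ofHom e)) (specMap₃_eq_specMap₂ f' (algebraMap V L) e f (algebraMap R Ω)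
      fun x => by rw [← pf, heV'])
  have hτ₁ : τ₁' ≫ specFractionFieldι V f' = specFractionFieldι R f ≫ τ₁ :=
    Over.OverMorphism.ext (specMap₂_eq_specMap₂ (algebraMap V L) e eV (algebraMap R Ω) fun z => (heV' z).symm)
  let τk₁ : specRingHomOver R f (IsLocalRing.residue R) ⟶ specRingHomOver V f' gV :=
    Over.homMk (𝟙 _) (by
      rw [Category.id_comp]
      exact specMap₂_eq_specMap₂ f' gV f _ fun x => by change IsLocalRing.residue R (eV (f' x)) = _; rw [pf])
  have hk₁ : τk₁ ≫ specRingHomι V f' gV = specRingHomι R f (IsLocalRing.residue R) ≫ τ₁ :=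
    Over.OverMorphism.ext (by
      change 𝟙 _ ≫ Spec.map _ = Spec.map _ ≫ Spec.map _; rw [Category.id_comp, specMap_comp_specMap_of_comp_eq eV _ _ rfl])
  have hQ' : Q = τ₁' ≫ ξ := Over.OverMorphism.ext (by rw [hQ]; rfl)
  have e1 : (reducePointMonoidHom R f 𝒳 (IsLocalRing.residue R) Q).left = (reducePointMonoidHom V f' 𝒳 gV ξ).left := by
    rw [hQ', reducePointMonoidHom_naturality₂ R V f f' 𝒳 (IsLocalRing.residue R) gV τ₁ τ₁' hτ₁ τk₁ hk₁ ξ, Over.comp_left]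
    exact Category.id_comp _
  -- (2) along `Spec sV : Spec (V, f' ∘ φ) → Spec (V, f')`
  let τ₂ : specValuationSubring V (f'.comp φ) ⟶ specValuationSubring V f' :=
    Over.homMk (Spec.map (CommRingCat.ofHom sV)) (specMap_comp_specMap_eq_of_comp_eq f' f' φ sV hsf)
  let τ₂' : specFractionField V (f'.comp φ) ⟶ specFractionField V f' :=
    Over.homMk (Spec.map (CommRingCat.ofHom s)) (specMap₃_eq_specMap₂ f' (algebraMap V L) s (f'.comp φ) (algebraMap V L)
      fun x => by rw [← hsV', ps, RingHom.comp_apply])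
  have hτ₂ : τ₂' ≫ specFractionFieldι V f' = specFractionFieldι V (f'.comp φ) ≫ τ₂ :=
    Over.OverMorphism.ext (specMap₂_eq_specMap₂ (algebraMap V L) s sV (algebraMap V L) fun z => (hsV' z).symm)
  let τk₂ : specRingHomOver V (f'.comp φ) gV ⟶ specRingHomOver V f' gV :=
    Over.homMk (Spec.map (CommRingCat.ofHom (iterateFrobenius (IsLocalRing.ResidueField R) p n)))
      (specMap₃_eq_specMap₂ f' gV (iterateFrobenius _ p n) (f'.comp φ) gV fun x => by
        change iterateFrobenius _ p n (gV (f' x)) = gV (f' (φ x)); rw [← ps, pF])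
  have hk₂ : τk₂ ≫ specRingHomι V f' gV = specRingHomι V (f'.comp φ) gV ≫ τ₂ :=
    Over.OverMorphism.ext (specMap₂_eq_specMap₂ gV (iterateFrobenius _ p n) sV gV fun z => (pF z).symm)
  have e2 : (reducePointMonoidHom V (f'.comp φ) 𝒳 gV (τ₂' ≫ ξ)).left =
      Spec.map (CommRingCat.ofHom (iterateFrobenius (IsLocalRing.ResidueField R) p n)) ≫
        (reducePointMonoidHom V f' 𝒳 gV ξ).left := by
    rw [reducePointMonoidHom_naturality₂ V V (f'.comp φ) f' 𝒳 gV gV τ₂ τ₂' hτ₂ τk₂ hk₂ ξ, Over.comp_left]; rfl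
  -- (3) along `Spec eV : Spec (R, f ∘ φ) → Spec (V, f' ∘ φ)` (twisted base points)
  let τ₃ : specValuationSubring R (f.comp φ) ⟶ specValuationSubring V (f'.comp φ) :=
    Over.homMk (Spec.map (CommRingCat.ofHom eV))
      (specMap_comp_specMap_of_comp_eq (f'.comp φ) eV (f.comp φ) (by rw [← RingHom.comp_assoc, hef]))
  let τ₃' : specFractionField R (f.comp φ) ⟶ specFractionField V (f'.comp φ) :=
    Over.homMk (Spec.map (CommRingCat.ofHom e)) (specMap₃_eq_specMap₂ (f'.comp φ) (algebraMap V L) e (f.comp φ)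
      (algebraMap R Ω) fun x => by rw [RingHom.comp_apply, RingHom.comp_apply, ← pf, heV'])
  have hτ₃ : τ₃' ≫ specFractionFieldι V (f'.comp φ) = specFractionFieldι R (f.comp φ) ≫ τ₃ :=
    Over.OverMorphism.ext (specMap₂_eq_specMap₂ (algebraMap V L) e eV (algebraMap R Ω) fun z => (heV' z).symm)
  let τk₃ : specRingHomOver R (f.comp φ) (IsLocalRing.residue R) ⟶ specRingHomOver V (f'.comp φ) gV :=
    Over.homMk (𝟙 _) (by
      rw [Category.id_comp]
      exact specMap₂_eq_specMap₂ (f'.comp φ) gV (f.comp φ) _ fun x => by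
        change IsLocalRing.residue R (eV (f' (φ x))) = IsLocalRing.residue R (f (φ x)); rw [pf])
  have hk₃ : τk₃ ≫ specRingHomι V (f'.comp φ) gV = specRingHomι R (f.comp φ) (IsLocalRing.residue R) ≫ τ₃ :=
    Over.OverMorphism.ext (by
      change 𝟙 _ ≫ Spec.map _ = Spec.map _ ≫ Spec.map _; rw [Category.id_comp, specMap_comp_specMap_of_comp_eq eV _ _ rfl])
  have hP'' : P' = τ₃' ≫ τ₂' ≫ ξ := Over.OverMorphism.ext (by
    rw [hP', Over.comp_left, Over.comp_left, CommRingCat.ofHom_comp, Spec.map_comp, Category.assoc]; rfl)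
  have e3 : (reducePointMonoidHom R (f.comp φ) 𝒳 (IsLocalRing.residue R) P').left =
      (reducePointMonoidHom V (f'.comp φ) 𝒳 gV (τ₂' ≫ ξ)).left := by
    rw [hP'', reducePointMonoidHom_naturality₂ R V (f.comp φ) (f'.comp φ) 𝒳 (IsLocalRing.residue R) gV τ₃ τ₃' hτ₃ τk₃
      hk₃ (τ₂' ≫ ξ), Over.comp_left]
    exact Category.id_comp _
  rw [e3, e2, e1]

end Generic

/-! ### §2. (T1) `ℤ̄_{𝔓₀}` versus the valuation ring `R` of `\bar{K_v}` along the chosen embedding `ι` -/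

section NumberField

open NumberField IsDedekindDomain IsDedekindDomain.HeightOneSpectrum IsLocalRing ValuativeRel
open scoped Valued Pointwise
open Literature.NumberTheory.GaloisRepresentations Literature.NumberTheory.DiophantineGeometry
open Literature.NumberTheory.GaloisRepresentations.IsNonarchimedeanLocalField (absMaximalIdeal
  mem_absMaximalIdeal_iff_algNorm_lt_one algNorm)

variable {K : Type} [Field K] [NumberField K] (v : HeightOneSpectrum (𝓞 K))

/-- `ι(ℤ̄_K) ⊆ R` (integrality along `𝓞 K → 𝒪_{K_v}`; `R` = absolute integers of `\bar{K_v}`). [cite: NeukirchANT1999, Ch. II §8] -/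
private theorem absClosureEmbedding_coe_absIntegers_mem_closureValuationSubring (s : absIntegers (𝓞 K) K) :
    absClosureEmbedding K (v.adicCompletion K) (s : AlgebraicClosure K) ∈ closureValuationSubring (v.adicCompletion K) := by
  have h := absClosureEmbedding_mem_absIntegers_integer K (v.adicCompletion K)
    (ValuativeRel.valuation (v.adicCompletion K))
    (fun r => (adicCompletion_valuation_le_one_iff K v _).mpr (norm_algebraMap_ringOfIntegers_le_one K v r)) s
  exact mem_closureValuationSubring_iff_mem_absIntegers.mpr h

/-- **`𝔓₀ = ι⁻¹(𝔪_R) ∩ ℤ̄_K`**: `s ∈ 𝔓₀ ↔ ι s ∈ 𝔪_R` (both say `|ι s| < 1`; the `v`-adic and the valuative norm are compared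
on the absolute integers of `\bar{K_v}` via `mem_radical_map_maximalIdeal_iff`). [cite: NeukirchANT1999, Ch. II §8] -/
private theorem mem_adicCompletionPrime_iff_absClosureEmbedding_mem_maximalIdeal (s : absIntegers (𝓞 K) K) :
    s ∈ adicCompletionPrime K v ↔
      (⟨absClosureEmbedding K (v.adicCompletion K) (s : AlgebraicClosure K),
          absClosureEmbedding_coe_absIntegers_mem_closureValuationSubring v s⟩ :
        closureValuationSubring (v.adicCompletion K)) ∈ maximalIdeal (closureValuationSubring (v.adicCompletion K)) := by
  have hS : absClosureEmbedding K (v.adicCompletion K) (s : AlgebraicClosure K) ∈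
      absIntegers (ValuativeRel.valuation (v.adicCompletion K)).integer (v.adicCompletion K) :=
    mem_closureValuationSubring_iff_mem_absIntegers.mp (absClosureEmbedding_coe_absIntegers_mem_closureValuationSubring v s)
  rw [mem_adicCompletionPrime_iff, mem_maximalIdeal_closureValuationSubring_iff]
  change _ ↔ algNorm (v.adicCompletion K)
    ((⟨_, hS⟩ : absIntegers (ValuativeRel.valuation (v.adicCompletion K)).integer (v.adicCompletion K)) : AlgebraicClosure (v.adicCompletion K)) < 1
  rw [← mem_absMaximalIdeal_iff_algNorm_lt_one]
  exact (mem_radical_map_maximalIdeal_iff (adicCompletion_valuation_le_one_iff K v) ⟨_, hS⟩).symm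

/-- For a unit `x` of a valuation ring `R ⊆ Ω`, `x⁻¹ ∈ R`. [folklore] -/
private theorem inv_mem_of_not_mem_maximalIdeal {Ω : Type} [Field Ω] (R : ValuationSubring Ω) {x : Ω} (hx : x ∈ R)
    (hu : (⟨x, hx⟩ : R) ∉ maximalIdeal R) : x⁻¹ ∈ R := by
  rw [IsLocalRing.mem_maximalIdeal, mem_nonunits_iff, not_not] at hu; obtain ⟨u, hu⟩ := hu
  have h1 : x * ((u⁻¹ : Rˣ) : R) = 1 := by
    have := congrArg (fun w : R => (w : Ω)) u.mul_inv
    simpa [hu] using this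
  rw [← eq_inv_of_mul_eq_one_right h1] at *
  exact ((u⁻¹ : Rˣ) : R).2

/-- **`ι(ℤ̄_{𝔓₀}) ⊆ R`** (`ι n ∈ R`, and `ι d ∈ Rˣ` for `d ∉ 𝔓₀`). [cite: NeukirchANT1999, Ch. II §8] -/
private theorem absClosureEmbedding_mem_closureValuationSubring_of_mem [(adicCompletionPrime K v).IsMaximal]
    {z : AlgebraicClosure K} (hz : z ∈ absIntegersValuationSubring (adicCompletionPrime K v)) :
    absClosureEmbedding K (v.adicCompletion K) z ∈ closureValuationSubring (v.adicCompletion K) := by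
  obtain ⟨n, d, hd, hzd⟩ := hz
  have hd0 : (d : AlgebraicClosure K) ≠ 0 := coe_ne_zero_of_notMem _ hd
  have hz' : z = (n : AlgebraicClosure K) * (d : AlgebraicClosure K)⁻¹ := by
    rw [← hzd, mul_inv_cancel_right₀ hd0]
  rw [hz', map_mul, map_inv₀]; refine mul_mem (absClosureEmbedding_coe_absIntegers_mem_closureValuationSubring v n)
    (inv_mem_of_not_mem_maximalIdeal _ (absClosureEmbedding_coe_absIntegers_mem_closureValuationSubring v d) ?_)
  rwa [← mem_adicCompletionPrime_iff_absClosureEmbedding_mem_maximalIdeal]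

/-- **`ι(𝔪_{ℤ̄_{𝔓₀}}) ⊆ 𝔪_R`**: if `z · d = n` with `n ∈ 𝔓₀ ∌ d`, then `ι z ∈ 𝔪_R`. [cite: NeukirchANT1999, Ch. II §8] -/
private theorem absClosureEmbedding_mem_maximalIdeal_of_mul_eq {z : AlgebraicClosure K} {n d : absIntegers (𝓞 K) K}
    (hn : n ∈ adicCompletionPrime K v) (hd : d ∉ adicCompletionPrime K v) (hzd : z * d = n)
    (hz : absClosureEmbedding K (v.adicCompletion K) z ∈ closureValuationSubring (v.adicCompletion K)) :
    (⟨absClosureEmbedding K (v.adicCompletion K) z, hz⟩ : closureValuationSubring (v.adicCompletion K)) ∈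
      maximalIdeal (closureValuationSubring (v.adicCompletion K)) := by
  have hd0 : (d : AlgebraicClosure K) ≠ 0 := coe_ne_zero_of_notMem _ hd
  have hdR := absClosureEmbedding_coe_absIntegers_mem_closureValuationSubring v d
  have hdu : (⟨_, hdR⟩ : closureValuationSubring (v.adicCompletion K)) ∉ maximalIdeal _ := by
    rwa [← mem_adicCompletionPrime_iff_absClosureEmbedding_mem_maximalIdeal]
  have hinv := inv_mem_of_not_mem_maximalIdeal _ hdR hdu
  have hz' : z = (n : AlgebraicClosure K) * (d : AlgebraicClosure K)⁻¹ := by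
    rw [← hzd, mul_inv_cancel_right₀ hd0]
  have key : (⟨absClosureEmbedding K (v.adicCompletion K) z, hz⟩ : closureValuationSubring (v.adicCompletion K)) =
      ⟨absClosureEmbedding K (v.adicCompletion K) n, absClosureEmbedding_coe_absIntegers_mem_closureValuationSubring v n⟩ *
        ⟨(absClosureEmbedding K (v.adicCompletion K) d)⁻¹, hinv⟩ :=
    Subtype.ext (by simp only [hz', map_mul, map_inv₀, MulMemClass.coe_mul])
  rw [key]
  exact Ideal.mul_mem_right _ _ ((mem_adicCompletionPrime_iff_absClosureEmbedding_mem_maximalIdeal v n).mp hn)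

/-- **`𝓞ᵥ ⊆ ℤ̄_{𝔓₀}`** (`a / s` with `a, s ∈ 𝓞 K`, `s ∉ v = 𝔓₀ ∩ 𝓞 K`). [cite: NeukirchANT1999, Ch. II §8] -/
theorem algebraMap_valuationSubringAtPrime_mem_absIntegersValuationSubring [(adicCompletionPrime K v).IsMaximal] (x : valuationSubringAtPrime K v) :
    algebraMap K (AlgebraicClosure K) (x : K) ∈ absIntegersValuationSubring (adicCompletionPrime K v) := by
  obtain ⟨a, b, hb, hx⟩ := (mem_valuationSubringAtPrime_iff v (x : K)).mp x.2
  refine ⟨algebraMap (𝓞 K) (absIntegers (𝓞 K) K) a, algebraMap (𝓞 K) (absIntegers (𝓞 K) K) b, fun h => hb ?_, ?_⟩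
  · have : b ∈ (adicCompletionPrime K v).under (𝓞 K) := h
    rwa [under_adicCompletionPrime] at this
  · have hbne : b ≠ 0 := fun h0 => hb (h0 ▸ v.asIdeal.zero_mem)
    have hb0 : (algebraMap (𝓞 K) (AlgebraicClosure K) b) ≠ 0 := by
      rw [IsScalarTower.algebraMap_apply (𝓞 K) K (AlgebraicClosure K), map_ne_zero]
      exact fun h => hbne (IsFractionRing.injective (𝓞 K) K (by rw [h, map_zero]))
    change algebraMap K (AlgebraicClosure K) (x : K) * algebraMap (𝓞 K) (AlgebraicClosure K) b =
      algebraMap (𝓞 K) (AlgebraicClosure K) a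
    rw [hx, map_mul, map_inv₀, ← IsScalarTower.algebraMap_apply, ← IsScalarTower.algebraMap_apply,
      inv_mul_cancel_right₀ hb0]

/-- `ι` on `𝓞ᵥ ⊆ K̄` is the structure map `𝓞ᵥ → R ⊆ \bar{K_v}` (`toClosureValuationSubring`): `K → K_v → \bar{K_v}` is
compatible with the chosen `K̄ → \bar{K_v}`. [cite: NeukirchANT1999, Ch. II §8] -/
theorem absClosureEmbedding_algebraMap_valuationSubringAtPrime (x : valuationSubringAtPrime K v) :
    absClosureEmbedding K (v.adicCompletion K) (algebraMap K (AlgebraicClosure K) (x : K)) =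
      ((toClosureValuationSubring v x : closureValuationSubring (v.adicCompletion K)) :
        AlgebraicClosure (v.adicCompletion K)) := by
  rw [AlgHom.commutes]
  exact (RingHom.congr_fun (algebraMap_comp_toClosureValuationSubring v) x).symm

/-! ### §3. (T2) A Frobenius `σ̃` at `𝔓₀` preserves `ℤ̄_{𝔓₀}` and raises `ι`-images to the `q`-th power modulo `𝔪_R` -/

/-- **`σ̃ ℤ̄_𝔓 ⊆ ℤ̄_𝔓`** for `σ̃ ∈ Aut(K̄)` with `σ̃ x ≡ x^q (mod 𝔓)` on `ℤ̄_K` (`q ≥ 1`, `𝔓` maximal; `σ̃ 𝔓 = 𝔓` by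
`apply_mem_prime_iff_of_sub_pow_mem`). [cite: NeukirchANT1999, Ch. I §9 Def. (9.5) and Prop. (9.1) (σ𝒪 = 𝒪)] -/
private theorem apply_mem_absIntegersValuationSubring_of_sub_pow_mem (σt : AlgebraicClosure K ≃+* AlgebraicClosure K)
    (𝔓 : Ideal (absIntegers (𝓞 K) K)) [𝔓.IsMaximal] (q : ℕ) (hq : 1 ≤ q)
    (hσ𝔓 : ∀ x : absIntegers (𝓞 K) K, ∃ hx : σt x ∈ absIntegers (𝓞 K) K,
      (⟨σt x, hx⟩ : absIntegers (𝓞 K) K) - x ^ q ∈ 𝔓)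
    {z : AlgebraicClosure K} (hz : z ∈ absIntegersValuationSubring 𝔓) : σt z ∈ absIntegersValuationSubring 𝔓 := by
  obtain ⟨n, d, hd, hzd⟩ := hz
  refine ⟨⟨σt n, (hσ𝔓 n).1⟩, ⟨σt d, (hσ𝔓 d).1⟩,
    fun h => hd ((apply_mem_prime_iff_of_sub_pow_mem σt 𝔓 q hσ𝔓 hq d).mp h), ?_⟩
  change σt z * σt d = σt n
  rw [← map_mul, hzd]

/-- **Residue law**: for `σ̃` a Frobenius at `𝔓₀` (`σ̃ x ≡ x^q (mod 𝔓₀)`, `q ≥ 1`) and `z = n/d ∈ ℤ̄_{𝔓₀}`, `ι(σ̃ z) ≡ ι(z)^q`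
in `κ(R)` (`(σ̃ z - z^q)(σ̃ d · d^q) = (σ̃ n - n^q) d^q + n^q (d^q - σ̃ d) ∈ 𝔓₀`). [cite: NeukirchANT1999, Ch. I §9 (9.4)] -/
private theorem residue_absClosureEmbedding_apply_eq_pow [(adicCompletionPrime K v).IsMaximal]
    (σt : AlgebraicClosure K ≃+* AlgebraicClosure K) (q : ℕ) (hq : 1 ≤ q)
    (hσ𝔓 : ∀ x : absIntegers (𝓞 K) K, ∃ hx : σt x ∈ absIntegers (𝓞 K) K,
      (⟨σt x, hx⟩ : absIntegers (𝓞 K) K) - x ^ q ∈ adicCompletionPrime K v)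
    {z : AlgebraicClosure K} (hz : z ∈ absIntegersValuationSubring (adicCompletionPrime K v)) :
    residue (closureValuationSubring (v.adicCompletion K))
        ⟨absClosureEmbedding K (v.adicCompletion K) (σt z), absClosureEmbedding_mem_closureValuationSubring_of_mem v
          (apply_mem_absIntegersValuationSubring_of_sub_pow_mem σt _ q hq hσ𝔓 hz)⟩ =
      residue (closureValuationSubring (v.adicCompletion K))
        ⟨absClosureEmbedding K (v.adicCompletion K) z, absClosureEmbedding_mem_closureValuationSubring_of_mem v hz⟩ ^ q := by
  obtain ⟨n, d, hd, hzd⟩ := hz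
  rw [← map_pow, ← sub_eq_zero, ← map_sub, IsLocalRing.residue_eq_zero_iff]
  -- numerator and denominator of `σ̃ z - z ^ q`
  have hd' : (⟨σt d, (hσ𝔓 d).1⟩ : absIntegers (𝓞 K) K) ∉ adicCompletionPrime K v :=
    fun h => hd ((apply_mem_prime_iff_of_sub_pow_mem σt _ q hσ𝔓 hq d).mp h)
  have hD : (⟨σt d, (hσ𝔓 d).1⟩ : absIntegers (𝓞 K) K) * d ^ q ∉ adicCompletionPrime K v := fun h =>
    ((Ideal.IsPrime.mem_or_mem inferInstance h).elim hd'
      fun h' => hd (Ideal.IsPrime.mem_of_pow_mem inferInstance q h'))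
  have hN : (⟨σt n, (hσ𝔓 n).1⟩ : absIntegers (𝓞 K) K) * d ^ q - n ^ q * ⟨σt d, (hσ𝔓 d).1⟩ ∈
      adicCompletionPrime K v := by
    have e : (⟨σt n, (hσ𝔓 n).1⟩ : absIntegers (𝓞 K) K) * d ^ q - n ^ q * ⟨σt d, (hσ𝔓 d).1⟩ =
        (⟨σt n, (hσ𝔓 n).1⟩ - n ^ q) * d ^ q - n ^ q * (⟨σt d, (hσ𝔓 d).1⟩ - d ^ q) := by ring
    rw [e]; exact Ideal.sub_mem _ (Ideal.mul_mem_right _ _ (hσ𝔓 n).2) (Ideal.mul_mem_left _ _ (hσ𝔓 d).2)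
  have hzd' : (σt z - z ^ q) * (((⟨σt d, (hσ𝔓 d).1⟩ : absIntegers (𝓞 K) K) * d ^ q : absIntegers (𝓞 K) K) :
      AlgebraicClosure K) =
      (((⟨σt n, (hσ𝔓 n).1⟩ : absIntegers (𝓞 K) K) * d ^ q - n ^ q * ⟨σt d, (hσ𝔓 d).1⟩ : absIntegers (𝓞 K) K) :
        AlgebraicClosure K) := by
    have h1 : σt z * σt d = σt n := by rw [← map_mul, hzd]
    simp only [MulMemClass.coe_mul, AddSubgroupClass.coe_sub, SubmonoidClass.coe_pow]
    change (σt z - z ^ q) * (σt d * (d : AlgebraicClosure K) ^ q) =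
      σt n * (d : AlgebraicClosure K) ^ q - (n : AlgebraicClosure K) ^ q * σt d
    rw [← h1, ← hzd]; ring
  have key := absClosureEmbedding_mem_maximalIdeal_of_mul_eq v hN hD hzd'
    (by rw [map_sub, map_pow]
        exact sub_mem (absClosureEmbedding_mem_closureValuationSubring_of_mem v
          (apply_mem_absIntegersValuationSubring_of_sub_pow_mem σt _ q hq hσ𝔓 ⟨n, d, hd, hzd⟩))
          (pow_mem (absClosureEmbedding_mem_closureValuationSubring_of_mem v ⟨n, d, hd, hzd⟩) q))
  convert key using 1
  exact Subtype.ext (by simp only [AddSubgroupClass.coe_sub, SubmonoidClass.coe_pow, map_sub, map_pow])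

/-! ### §4. (T3, number field) The slot statement -/

/-- **(T3) «Frobenius translate at the base point»** ([Shimura1998] proof of Thm. 18.6, p. 127 «`(Y^σ)~ = Ỹ^f`», p. 128 «`(t^σ)~ = π(t̃)`»;
[SerreTate1968] §1): for `γ ∈ Aut(K/F₀)` with `γ • v = v` (`γᵥ` the induced automorphism of `𝓞ᵥ`), `σ̃ ∈ Aut(K̄)` over `γ` with
`σ̃ x ≡ x^q (mod 𝔓₀)` on `ℤ̄_K` (`q = pⁿ`, `𝔓₀` the prime of the chosen `ι : K̄ → \bar{K_v}`), any structure map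
`f' : 𝓞ᵥ → ℤ̄_{𝔓₀}` with underlying map `𝓞ᵥ ⊆ K ⊆ K̄`, a proper `𝓞ᵥ`-group scheme `𝒳`, a `K̄`-point `ξ` of `𝒳` over `ℤ̄_{𝔓₀}`,
the `\bar{K_v}`-point `Q` over `(R, f)` lying over `Spec ι ≫ ξ` and the `\bar{K_v}`-point `P′` over the TWISTED base point
`(R, f ∘ γᵥ)` lying over `Spec (ι ∘ σ̃) ≫ ξ`: `red(P′) = Spec Frobⁿ_{κ(R)} ≫ red(Q)`.
[cite: Shimura1998, §18.6 proof of Thm. 18.6, pp. 127–128] [cite: Hartshorne1977, II.4.7] -/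
theorem reducePointMonoidHom_left_eq_frobenius_comp_of_frobeniusAt [(adicCompletionPrime K v).IsMaximal]
    {F₀ : Type} [Field F₀] [Algebra F₀ K] (γ : K ≃ₐ[F₀] K) (hγv : γ • v.asIdeal = v.asIdeal) (p n : ℕ)
    [ExpChar (ResidueField (closureValuationSubring (v.adicCompletion K))) p] (q : ℕ) (hq : q = p ^ n)
    (σt : AlgebraicClosure K ≃+* AlgebraicClosure K)
    (hσa : ∀ a : K, σt (algebraMap K (AlgebraicClosure K) a) = algebraMap K (AlgebraicClosure K) (γ.toRingEquiv a))
    (hσ𝔓 : ∀ x : absIntegers (𝓞 K) K, ∃ hx : σt x ∈ absIntegers (𝓞 K) K,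
      (⟨σt x, hx⟩ : absIntegers (𝓞 K) K) - x ^ q ∈ adicCompletionPrime K v)
    (f' : valuationSubringAtPrime K v →+* absIntegersValuationSubring (adicCompletionPrime K v))
    (hf' : ∀ x : valuationSubringAtPrime K v,
      ((f' x : absIntegersValuationSubring (adicCompletionPrime K v)) : AlgebraicClosure K) =
        algebraMap K (AlgebraicClosure K) (x : K))
    (𝒳 : SchemeOver (valuationSubringAtPrime K v)) [GrpObj 𝒳] [IsProper 𝒳.hom]
    (ξ : specFractionField (absIntegersValuationSubring (adicCompletionPrime K v)) f' ⟶ 𝒳)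
    (Q : specFractionField (closureValuationSubring (v.adicCompletion K)) (toClosureValuationSubring v) ⟶ 𝒳)
    (P' : specFractionField (closureValuationSubring (v.adicCompletion K))
      ((toClosureValuationSubring v).comp (algEquivValuationSubring v γ hγv).toRingHom) ⟶ 𝒳)
    (hQ : Q.left = Spec.map (CommRingCat.ofHom (absClosureEmbedding K (v.adicCompletion K)).toRingHom) ≫ ξ.left)
    (hP' : P'.left = Spec.map (CommRingCat.ofHom
      ((absClosureEmbedding K (v.adicCompletion K)).toRingHom.comp σt.toRingHom)) ≫ ξ.left) :
    (reducePointMonoidHom (closureValuationSubring (v.adicCompletion K))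
        ((toClosureValuationSubring v).comp (algEquivValuationSubring v γ hγv).toRingHom) 𝒳
        (residue (closureValuationSubring (v.adicCompletion K))) P').left =
      Spec.map (CommRingCat.ofHom (iterateFrobenius (ResidueField (closureValuationSubring (v.adicCompletion K))) p n)) ≫
        (reducePointMonoidHom (closureValuationSubring (v.adicCompletion K)) (toClosureValuationSubring v) 𝒳
          (residue (closureValuationSubring (v.adicCompletion K))) Q).left := by
  subst hq
  have hq1 : 1 ≤ p ^ n :=
    Nat.one_le_pow _ _ (expChar_pos (ResidueField (closureValuationSubring (v.adicCompletion K))) p)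
  -- the restrictions `ι|_{ℤ̄_𝔓} : ℤ̄_𝔓 → R` and `σ̃|_{ℤ̄_𝔓} : ℤ̄_𝔓 → ℤ̄_𝔓`
  let eV : absIntegersValuationSubring (adicCompletionPrime K v) →+* closureValuationSubring (v.adicCompletion K) :=
    (((absClosureEmbedding K (v.adicCompletion K)).toRingHom.comp
        (absIntegersValuationSubring (adicCompletionPrime K v)).subtype).codRestrict
      (closureValuationSubring (v.adicCompletion K)))
      fun z => absClosureEmbedding_mem_closureValuationSubring_of_mem v z.2
  let sV : absIntegersValuationSubring (adicCompletionPrime K v) →+* absIntegersValuationSubring (adicCompletionPrime K v) :=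
    ((σt.toRingHom.comp (absIntegersValuationSubring (adicCompletionPrime K v)).subtype).codRestrict
      (absIntegersValuationSubring (adicCompletionPrime K v)))
      fun z => apply_mem_absIntegersValuationSubring_of_sub_pow_mem σt _ (p ^ n) hq1 hσ𝔓 z.2
  have heV : ∀ z : absIntegersValuationSubring (adicCompletionPrime K v),
      ((eV z : closureValuationSubring (v.adicCompletion K)) : AlgebraicClosure (v.adicCompletion K)) =
        (absClosureEmbedding K (v.adicCompletion K)).toRingHom (z : AlgebraicClosure K) := fun z => rfl
  have hef : eV.comp f' = toClosureValuationSubring v := by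
    refine RingHom.ext fun x => Subtype.ext ?_
    change absClosureEmbedding K (v.adicCompletion K)
      ((f' x : absIntegersValuationSubring (adicCompletionPrime K v)) : AlgebraicClosure K) = _
    rw [hf', absClosureEmbedding_algebraMap_valuationSubringAtPrime]
  have hsV : ∀ z : absIntegersValuationSubring (adicCompletionPrime K v),
      ((sV z : absIntegersValuationSubring (adicCompletionPrime K v)) : AlgebraicClosure K) =
        σt.toRingHom (z : AlgebraicClosure K) := fun z => rfl
  have hsf : sV.comp f' = f'.comp (algEquivValuationSubring v γ hγv).toRingHom := by
    refine RingHom.ext fun x => Subtype.ext ?_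
    change σt ((f' x : absIntegersValuationSubring (adicCompletionPrime K v)) : AlgebraicClosure K) =
      ((f' (algEquivValuationSubring v γ hγv x) : absIntegersValuationSubring (adicCompletionPrime K v)) :
        AlgebraicClosure K)
    rw [hf', hf', coe_algEquivValuationSubring, hσa]
    rfl
  have hres : ∀ z : absIntegersValuationSubring (adicCompletionPrime K v),
      residue (closureValuationSubring (v.adicCompletion K)) (eV (sV z)) =
        residue (closureValuationSubring (v.adicCompletion K)) (eV z) ^ p ^ n := fun z =>
    residue_absClosureEmbedding_apply_eq_pow v σt (p ^ n) hq1 hσ𝔓 z.2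
  exact reducePointMonoidHom_left_eq_frobenius_comp_of_conj (absIntegersValuationSubring (adicCompletionPrime K v))
    (closureValuationSubring (v.adicCompletion K)) f' (toClosureValuationSubring v)
    (algEquivValuationSubring v γ hγv).toRingHom (absClosureEmbedding K (v.adicCompletion K)).toRingHom eV
    σt.toRingHom sV p n heV hef hsV hsf hres 𝒳 ξ Q P' hQ hP'

end NumberField

end Literature.AlgebraicGeometry.Motives

end
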